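import Mathlib
import Summits.CriticalPhenomena.PercolationContinuityZ3.Theorems.PercNearOneGluingAdditiveGluingBasePeel
import Literature.Probability.Percolation.TwoSeparationSets
import HarnessLib

/-!
# `NoHeavyLowerTail` (stmt-CriticalPhenomena-4575), line fat-minority-linear — gluing ports to an observer seen
# from a SEPARATED vertex: the conditional law of a decreasing cluster event is monotone (route task
# `nh-dp-fatminority`, gen 11; step (C2) of THEOREM C in PROOF-UT4-upto3ports.md)

`μ = prodBernoulli w` on the pairs of `Fin n`; `o, c` vertices; `T` a finite set of vertices; `Q` a decreasing event
determined by the open edge cluster `C_c` of `c`.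

* `notReach_union_starPairs_iff`, `openEdgeCluster_union_starPairs_eq`: opening the pairs `s(o,u)`, `u ∈ T`, keeps
  `c` separated from `o` iff `c` was separated from `o` and from `T`, and then does not change `C_c`.
* `glueStar_real_notConn`: if `w₂` is `w₁` with those pairs forced open, `μ₂{c↮o} = μ₁({c↮o} ∩ {c↮T})` and
  `μ₂({c↮o} ∩ Q) = μ₁({c↮o} ∩ {c↮T} ∩ Q)` (push-forward `glueSet_pushforward`).
* `notConn_condProb_mono`: `μ(Q | c↮o, c↮T) ≥ μ(Q | c↮o)` in cross-multiplied form — van den Berg–Häggström–Kahn's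
  Theorem 1.1 (`BHK2006_twoSeparationSets`) with `X = {o} ∪ T`, `Y = {o}`, `A = Qᶜ`, `B = Ω`.
No definitions.
-/

namespace Summit.CriticalPhenomena.PercolationContinuityZ3.Theorems

open MeasureTheory Set
open Literature.Probability.LatticeModels (prodBernoulli)
open Literature.Probability.Percolation

noncomputable section
open scoped Classical

variable {n : ℕ}

/-! ### 1. Gluing extra ports to the observer, seen from a vertex separated from it -/

/-- If `c` is separated from `o` and from every `u ∈ T` in `ω`, it stays separated from `o` after the pairs
`s(o,u)`, `u ∈ T`, are opened, and conversely. [folklore] -/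
theorem notReach_union_starPairs_iff (o c : Fin n) (T : Finset (Fin n)) (ω : BondConfig (Fin n)) :
    ¬ (openGraph ((ω ∪ {e | ∃ u ∈ T, e = s(o, u)}) : BondConfig (Fin n))).Reachable c o ↔
      (¬ (openGraph ω).Reachable c o ∧ ∀ u ∈ T, ¬ (openGraph ω).Reachable c u) := by
  set E : Set (Sym2 (Fin n)) := {e | ∃ u ∈ T, e = s(o, u)} with hE
  constructor
  · intro h
    refine ⟨fun hco => h (hco.mono (openGraph_mono subset_union_left)), fun u hu hcu => h ?_⟩
    by_cases huo : u = o
    · exact (huo ▸ hcu).mono (openGraph_mono subset_union_left)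
    · have hadj : (openGraph ((ω ∪ E : Set (Sym2 (Fin n))) : BondConfig (Fin n))).Adj u o :=
        (openGraph_adj _ u o).2 ⟨Or.inr ⟨u, hu, Sym2.eq_swap⟩, huo⟩
      exact (hcu.mono (openGraph_mono subset_union_left)).trans hadj.reachable
  · rintro ⟨hco, hT⟩ h
    have hD : ∀ e ∈ E, ∀ x ∈ e, x ∈ ({x | x = o ∨ x ∈ T} : Set (Fin n)) := by
      rintro e ⟨u, hu, rfl⟩ x hx
      rcases Sym2.mem_iff.1 hx with rfl | rfl
      · exact Or.inl rfl
      · exact Or.inr hu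
    have hM : ∀ x ∈ ({x | x = o ∨ x ∈ T} : Set (Fin n)), ¬ (openGraph ω).Reachable c x := by
      rintro x (rfl | hx)
      · exact hco
      · exact hT x hx
    exact hco (reachable_of_union_of_avoids hD hM h)

/-- Under the same separation, opening the pairs `s(o,u)`, `u ∈ T`, does not change the open edge cluster of `c`.
[folklore] -/
theorem openEdgeCluster_union_starPairs_eq (o c : Fin n) (T : Finset (Fin n)) (ω : BondConfig (Fin n))
    (hco : ¬ (openGraph ω).Reachable c o) (hT : ∀ u ∈ T, ¬ (openGraph ω).Reachable c u) :
    openEdgeCluster ((ω ∪ {e | ∃ u ∈ T, e = s(o, u)}) : BondConfig (Fin n)) c = openEdgeCluster ω c := by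
  set E : Set (Sym2 (Fin n)) := {e | ∃ u ∈ T, e = s(o, u)} with hE
  have hD : ∀ e ∈ E, ∀ x ∈ e, x ∈ ({x | x = o ∨ x ∈ T} : Set (Fin n)) := by
    rintro e ⟨u, hu, rfl⟩ x hx
    rcases Sym2.mem_iff.1 hx with rfl | rfl
    · exact Or.inl rfl
    · exact Or.inr hu
  have hM : ∀ x ∈ ({x | x = o ∨ x ∈ T} : Set (Fin n)), ¬ (openGraph ω).Reachable c x := by
    rintro x (rfl | hx)
    · exact hco
    · exact hT x hx
  have hsep : ¬ (openGraph ((ω ∪ E : Set (Sym2 (Fin n))) : BondConfig (Fin n))).Reachable c o :=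
    (notReach_union_starPairs_iff o c T ω).2 ⟨hco, hT⟩
  ext e
  simp only [openEdgeCluster, mem_setOf_eq]
  constructor
  · rintro ⟨hmem, hdiag, hreach⟩
    have hreach' : ∀ v ∈ e, (openGraph ω).Reachable c v :=
      fun v hv => reachable_of_union_of_avoids hD hM (hreach v hv)
    refine ⟨?_, hdiag, hreach'⟩
    rcases hmem with hω | ⟨u, hu, rfl⟩
    · exact hω
    · exact (hsep (hreach o (Sym2.mem_mk_left o u))).elim
  · rintro ⟨hmem, hdiag, hreach⟩
    exact ⟨Or.inl hmem, hdiag, fun v hv => (hreach v hv).mono (openGraph_mono subset_union_left)⟩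

/-! ### 2. The conditional probability `κ = μ(Q | c ↮ o)` and its monotonicity under gluing -/

/-- **Pull-back of `{c ↮ o}` and `{c ↮ o} ∩ Q` along the gluing `ω ↦ ω ∪ {s(o,u) : u ∈ T}`**: if `w₂ = 1` on
these pairs and `w₂ = w₁` elsewhere, then `μ₂{c↮o} = μ₁({c↮o} ∩ {c↮T})` and
`μ₂({c↮o} ∩ Q) = μ₁({c↮o} ∩ {c↮T} ∩ Q)` for every event `Q` determined by (and decreasing in) `C_c`.
[folklore; Grimmett 1999 §1.3] -/
theorem glueStar_real_notConn (w₁ w₂ : Sym2 (Fin n) → unitInterval) (o c : Fin n) (T : Finset (Fin n))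
    (h1 : ∀ e ∈ ({e | ∃ u ∈ T, e = s(o, u)} : Set (Sym2 (Fin n))), w₂ e = 1)
    (h2 : ∀ e ∉ ({e | ∃ u ∈ T, e = s(o, u)} : Set (Sym2 (Fin n))), w₂ e = w₁ e)
    (Q : Set (BondConfig (Fin n)))
    (hQ : ∀ ω ω', ω ∈ Q → openEdgeCluster ω' c ⊆ openEdgeCluster ω c → ω' ∈ Q) :
    (prodBernoulli w₂).real (openConn c o)ᶜ =
        (prodBernoulli w₁).real ((openConn c o)ᶜ ∩ {ω | ∀ u ∈ T, ¬ (openGraph ω).Reachable c u}) ∧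
      (prodBernoulli w₂).real ((openConn c o)ᶜ ∩ Q) =
        (prodBernoulli w₁).real ((openConn c o)ᶜ ∩ {ω | ∀ u ∈ T, ¬ (openGraph ω).Reachable c u} ∩ Q) := by
  set E : Set (Sym2 (Fin n)) := {e | ∃ u ∈ T, e = s(o, u)} with hE
  constructor
  · rw [glueSet_pushforward w₁ w₂ E h1 h2]
    congr 1
    ext ω
    simp only [mem_setOf_eq, mem_inter_iff, mem_compl_iff, openConn]
    exact notReach_union_starPairs_iff o c T ω
  · rw [glueSet_pushforward w₁ w₂ E h1 h2]
    congr 1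
    ext ω
    simp only [mem_setOf_eq, mem_inter_iff, mem_compl_iff, openConn]
    constructor
    · rintro ⟨hsep, hQ'⟩
      obtain ⟨hco, hT⟩ := (notReach_union_starPairs_iff o c T ω).1 hsep
      refine ⟨⟨hco, hT⟩, hQ _ _ hQ' ?_⟩
      rw [openEdgeCluster_union_starPairs_eq o c T ω hco hT]
    · rintro ⟨⟨hco, hT⟩, hQ'⟩
      refine ⟨(notReach_union_starPairs_iff o c T ω).2 ⟨hco, hT⟩, hQ _ _ hQ' ?_⟩
      rw [openEdgeCluster_union_starPairs_eq o c T ω hco hT]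

/-- **Separating `c` from more vertices makes a decreasing `C_c`-event more likely** (BHK Thm 1.1 with
`X = {o} ∪ T`, `Y = {o}`, `A = Qᶜ`, `B = Ω`): `μ({c↮o} ∩ Q) · μ({c↮o} ∩ {c↮T}) ≤ μ({c↮o} ∩ {c↮T} ∩ Q) · μ{c↮o}`.
[cite: VandenbergHaggstromKahn2005, Thm. 1.1 (p. 3, eq. (3))] -/
theorem notConn_condProb_mono (w : Sym2 (Fin n) → unitInterval) (o c : Fin n) (T : Finset (Fin n))
    (Q : Set (BondConfig (Fin n)))
    (hQ : ∀ ω ω', ω ∈ Q → openEdgeCluster ω' c ⊆ openEdgeCluster ω c → ω' ∈ Q) :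
    (prodBernoulli w).real ((openConn c o)ᶜ ∩ Q) *
        (prodBernoulli w).real ((openConn c o)ᶜ ∩ {ω | ∀ u ∈ T, ¬ (openGraph ω).Reachable c u}) ≤
      (prodBernoulli w).real ((openConn c o)ᶜ ∩ {ω | ∀ u ∈ T, ¬ (openGraph ω).Reachable c u} ∩ Q) *
        (prodBernoulli w).real (openConn c o)ᶜ := by
  -- `Qᶜ` as an increasing predicate of the edge cluster of `c`
  set P : Set (Sym2 (Fin n)) → Prop := fun C => ∃ ω', ω' ∉ Q ∧ openEdgeCluster ω' c ⊆ C with hP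
  have hPmono : ∀ ⦃C C' : Set (Sym2 (Fin n))⦄, C ⊆ C' → P C → P C' :=
    fun C C' hCC' ⟨ω', hω', hsub⟩ => ⟨ω', hω', hsub.trans hCC'⟩
  have hPQ : {ω : BondConfig (Fin n) | P (openEdgeCluster ω c)} = Qᶜ := by
    ext ω
    simp only [mem_setOf_eq, mem_compl_iff, hP]
    constructor
    · rintro ⟨ω', hω', hsub⟩ hωQ
      exact hω' (hQ ω ω' hωQ hsub)
    · intro hω
      exact ⟨ω, hω, subset_rfl⟩
  set X : Set (Fin n) := {x | x = o ∨ x ∈ T} with hX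
  have key := BHK2006_twoSeparationSets w c X {o} P (fun _ => True) hPmono (fun _ _ _ h => h)
  have hXo : X ∩ {o} = {o} := by
    ext x; simp only [hX, mem_inter_iff, mem_setOf_eq, mem_singleton_iff]; tauto
  have hXo' : X ∪ {o} = X := by
    ext x; simp only [hX, mem_union, mem_setOf_eq, mem_singleton_iff]; tauto
  rw [hXo, hXo', hPQ] at key
  have hDo : {ω : BondConfig (Fin n) | ∀ x ∈ ({o} : Set (Fin n)), ¬ (openGraph ω).Reachable c x} =
      (openConn c o)ᶜ := by
    ext ω; simp [openConn]
  have hDX : {ω : BondConfig (Fin n) | ∀ x ∈ X, ¬ (openGraph ω).Reachable c x} =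
      (openConn c o)ᶜ ∩ {ω | ∀ u ∈ T, ¬ (openGraph ω).Reachable c u} := by
    ext ω
    simp only [hX, mem_setOf_eq, mem_inter_iff, mem_compl_iff, openConn]
    constructor
    · intro h; exact ⟨h o (Or.inl rfl), fun u hu => h u (Or.inr hu)⟩
    · rintro ⟨h1, h2⟩ x (rfl | hx); exacts [h1, h2 x hx]
  have htrue : ({ω : BondConfig (Fin n) | P (openEdgeCluster ω c)} ∩ {ω | True}) = Qᶜ := by
    rw [hPQ]; ext ω; simp
  simp only [hDo, hDX, setOf_true, inter_univ] at key
  -- key : μ(D ∩ N ∩ Qᶜ) * μ(D) ≤ μ(D ∩ Qᶜ) * μ(D ∩ N)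
  have hmQ : MeasurableSet (Q : Set (BondConfig (Fin n))) := MeasurableSet.of_discrete
  have hs1 := measureReal_inter_add_sdiff (μ := prodBernoulli w) (s := (openConn c o)ᶜ) hmQ
  have hs2 := measureReal_inter_add_sdiff (μ := prodBernoulli w)
    (s := (openConn c o)ᶜ ∩ {ω | ∀ u ∈ T, ¬ (openGraph ω).Reachable c u}) hmQ
  rw [Set.sdiff_eq] at hs1 hs2
  have ha : (prodBernoulli w).real ((openConn c o)ᶜ ∩ Q) =
      (prodBernoulli w).real (openConn c o)ᶜ - (prodBernoulli w).real ((openConn c o)ᶜ ∩ Qᶜ) := by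
    linarith
  have hb : (prodBernoulli w).real ((openConn c o)ᶜ ∩ {ω | ∀ u ∈ T, ¬ (openGraph ω).Reachable c u} ∩ Q) =
      (prodBernoulli w).real ((openConn c o)ᶜ ∩ {ω | ∀ u ∈ T, ¬ (openGraph ω).Reachable c u}) -
        (prodBernoulli w).real ((openConn c o)ᶜ ∩ {ω | ∀ u ∈ T, ¬ (openGraph ω).Reachable c u} ∩ Qᶜ) := by
    linarith
  rw [ha, hb]
  nlinarith [key]

end

end Summit.CriticalPhenomena.PercolationContinuityZ3.Theorems
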